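import Literature.AnabelianGeometry.EtaleTheta.ThetaCoversTemperedOfHuu
import Literature.AnabelianGeometry.EtaleTheta.Discharge.Sec2OrbitEmbeddingOuterBinders
import Literature.AnabelianGeometry.EtaleTheta.Discharge.Sec2OuterPairOfCLevelData
import Literature.AnabelianGeometry.EtaleTheta.SettingModelChiMuTwoInversionCusp
import Literature.AnabelianGeometry.EtaleTheta.ThetaQuotientsOfCurveTopology
import HarnessLib

/-!
# [EtTh] Cor 2.8 (i)/(iii), OUTER case, at the §1 model: the residual binders `hα` / `hβ` / `hXuι` of the
# outer chain are THEOREMS for abc-iut-L2-d3's orbit embedding `orbitEmbeddingOfHuu` (proof-only)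

Mochizuki, *The Étale Theta Function …* [EtTh], Publ. RIMS 45 (2009), §2, Cor 2.8 (i), (iii), PRIMS PDF p.42
("if `γ` arises from an inner automorphism of `Π^tp_{Ċ̲̲}` (resp. `Π^tp_{Ċ̲}`), then `γ` preserves `η̲̈^{Θ,l·ℤ}`
(resp. `η̈^{Θ,l·ℤ}`)"; "(i) … preserves the property … of standard type … up to … a root of unity of order `l`
(resp. `1`; `l`; `1`)"), Def 1.7 p.27 (`Π^tp_X ⊆ Π^tp_C`), Prop 2.4 p.38, Def 2.5 (i) p.39 (bib key `MochizukiEtTh2009`).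

PROOF-ONLY companion (no `def`, no instance, no new `Prop`; cell abc-iut, layer L2, seat abc-iut-w6-d049 gen 4, row R358
«COR 2.8 (i) RESIDUAL BINDERS hα / hβ / hXuι» of abc-iut-L2-lead 2026-08-26T12:34:13Z) of the OUTER chain for node
EtTh:Cor2.8(i)/(iii): `Sec2Cor28iiiOuterOfEmbedding` (p434590) → `Sec2OrbitEmbeddingOuterTransport` (p436384) →
`Sec2Cor28iiiOuterAssembly` (p436513) → `Sec2OrbitEmbeddingOuterBinders` (p437630). After p437630 the outer clauses of
`ThetaOrbitData.Cor28_iii` / `Cor28_i` at `ThetaOrbitData.ofEmbedding ε hC hS` hold for a conjugator `x ∈ Π^tp_C` with an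
automorphism pair `(α, β)` modulo, besides Cor 2.8's own binders and P-C5: the PAIR EQUATIONS
`hα : ι ∘ α = conj_x ∘ ι`, `hβ : β ∘ toTheta = toTheta ∘ α`, and the identification `hXuι : ι(Π^tp_{X̲}) = T.tp T.PiXu`.
THIS file discharges all three for the orbit embedding abc-iut-L2-d3 (gen 6) CONSTRUCTED at a `MuTwoSetting` with C-level
data (`CLevelData.orbitEmbeddingOfHuu`, `ThetaCoversTemperedOfHuu`, p449577: `ι := inclX` into the cover
`temperedCoverDataOfHuu` whose `Π^tp_C` is `M.GtpC`), for EVERY `x ∈ Π^tp_C`, with the pair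
`(α, β) := (e.conjX x, Thm16Sub.topCompanion …)` of abc-iut-w6-d051's `CLevelData.outer_pair_equations`
(`Sec2OuterPairOfCLevelData`), granted the quotient-map property of `toTheta` (true at every χ-model, §3):
* §1 `orbitEmbeddingOfHuu_ι_conjX` — **hα**: `ι (e.conjX x σ) = x · ι σ · x⁻¹` (abc-iut-L2-d3's `inclX_conjX`);
  `orbitEmbeddingOfHuu_map_GtpXu` — **hXuι**: `ι(Π^tp_{X̲}) = T.tp T.PiXu` (abc-iut-L2-d3's
  `temperedCoverDataOfHuu_tp_PiXu`, Prop 2.4: `Π^tp_{X̲}` of the assembled cover IS `inclX(Π^tp_{X̲})`);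
  `orbitEmbeddingOfHuu_topCompanion_toTheta` — **hβ** (abc-iut-w6-d051's `outer_pair_equations`);
* §2 the capstones with the three binders GONE: `cor28_iii_outer_orbitEmbeddingOfHuu` (conjuncts 3–4 of `Cor28_iii`
  at `ofEmbedding (orbitEmbeddingOfHuu …)`) and `cor28_i_outer_orbitEmbeddingOfHuu` (the four conclusions of `Cor28_i`,
  `κ = 1`) — residual = abc-iut-L2-d3's constructor binders (`op`, `hIx`, `hιell`, `hN`, `hY`, `hK`, `IotaStable`,
  `CuspAdapted`, `τ^{±1}`), `IsQuotientMap toTheta`, `Compat`/`Sec2Hyps`, Cor 2.8's OWN binders (`IsStandard`, `Γ_Θ` with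
  `InducesOnTheta`, `hY`/`hYuu`, tower stabilities), and P-C5 (`σ₀ ∈ Π^tp_{X̲̲}`, `hη`; GAP-LEDGER G-w6d049-1);
* §3 `isQuotientMap_toTheta_modelχ'` — the quotient-map input at abc-iut-w5-d029's cusped χ-model (abc-iut-w5-d111's
  generic `CurveTheta.isQuotientMap_toTheta`), and `cor28_i_outer_orbitEmbeddingOfHuu_inversionModelχ'` — the Cor 2.8 (i)
  capstone at `MuTwoSetting.inversionModelχ′` (the site abc-iut-L2-d3 names for the instance; at the cusp-free
  `inversionModelχ` the constructor's cusp binder is vacuous) with `hq` discharged.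
HONEST FRAMING: [EtTh] is refereed; statements about the TYPED interface at a semi-synthetic model constructor (consistency /
non-vacuity evidence only); P-C5 and the constructor binders stay in hypothesis position and are NOT asserted; no side is
taken on [IUTchIII] Cor 3.12; typed ≠ proved.
-/

noncomputable section

namespace Literature.AnabelianGeometry.EtaleTheta

open Literature.AnabelianGeometry.SemiGraphs ThetaCovers Literature.IUT.HodgeArakelov
open _root_.Topology
open ThetaSetting.EtaleThetaData.DoubleUnderline.OrbitEmbedding (symm_toTheta_eq)

namespace MuTwoSetting.CLevelData

variable {p : ℕ} [Fact p.Prime] {M : MuTwoSetting p}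
variable {PC : Type} [Group PC] [TopologicalSpace PC] [IsTopologicalGroup PC] [T2Space PC]

section Generic

variable (e : M.CLevelData) (ιC : M.GtpC →ₜ* PC) (hιC : IsProfiniteCompletion ιC)
  (hinj : Function.Injective ιC) (op : M.toThetaSetting.OncePuncturedData) {l : ℕ} (hodd : Odd l)
  {x : M.Pt} (hx : M.IsCusp x)
  (hIx : ((e.piCDataOf ιC hιC).Dx x ⊓ (e.piCDataOf ιC hιC).augGK.ker) ⊔ (e.piCDataOf ιC hιC).barKer l =
    (e.piCDataOf ιC hιC).barTheta l)
  (hιell : ∀ c ∈ (e.piCDataOf ιC hιC).augGK.ker, c ∉ (e.piCDataOf ιC hιC).PiX →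
    ∀ d ∈ (e.piCDataOf ιC hιC).PiX ⊓ (e.piCDataOf ιC hιC).augGK.ker,
      c * d * c⁻¹ * d ∈ (e.piCDataOf ιC hιC).barTheta l)
  (hN : ((M.GtpXu l).map M.inclX).Normal) (hY : (M.GtpY.map M.inclX).Normal)
  {E : M.toThetaSetting.EtaleThetaData} (C : E.DoubleUnderline l) (hK : M.barKerTp l ≤ C.Huu)
  {g : M.GtpC} (hgX : g ∉ M.inclX.range) (hι : C.IotaStable (e.conjX g)) (hA : C.CuspAdapted x)
  (τ τ' : ThetaSetting.NonCuspidalPoint E.toKummerData)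

/-! ## §1. The three binders at `orbitEmbeddingOfHuu` -/

/-- **Binder `hα` DISCHARGED**: for every `y ∈ Π^tp_C` the orbit embedding `ι = inclX` intertwines the restricted inner
automorphism `e.conjX y` of `Π^tp_X` with conjugation by `y` — `ι (α σ) = y · ι σ · y⁻¹` (abc-iut-L2-d3's `inclX_conjX`).
[cite: MochizukiEtTh2009, Cor 2.8(iii) p.42] -/
theorem orbitEmbeddingOfHuu_ι_conjX (y : (e.temperedCoverDataOfHuu ιC hιC hinj op hodd hx hIx hιell hN hY C hK hgX hι hA).Gtp)
    (σ : M.PiTemp) :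
    (e.orbitEmbeddingOfHuu ιC hιC hinj op hodd hx hIx hιell hN hY C hK hgX hι hA τ τ').ι (e.conjX y σ) =
      y * (e.orbitEmbeddingOfHuu ιC hιC hinj op hodd hx hIx hιell hN hY C hK hgX hι hA τ τ').ι σ * y⁻¹ :=
  e.inclX_conjX y σ

/-- **Binder `hXuι` DISCHARGED**: `ι(Π^tp_{X̲}) = T.tp T.PiXu` — the single-underline member of the assembled cover, pulled
back to `Π^tp_C`, IS the image of `Π^tp_{X̲}` (abc-iut-L2-d3's `temperedCoverDataOfHuu_tp_PiXu`).
[cite: MochizukiEtTh2009, Prop 2.4 p.38] -/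
theorem orbitEmbeddingOfHuu_map_GtpXu :
    (M.toThetaSetting.GtpXu l).map (e.orbitEmbeddingOfHuu ιC hιC hinj op hodd hx hIx hιell hN hY C hK hgX hι hA τ τ').ι =
      (e.temperedCoverDataOfHuu ιC hιC hinj op hodd hx hIx hιell hN hY C hK hgX hι hA).tp
        (e.temperedCoverDataOfHuu ιC hιC hinj op hodd hx hIx hιell hN hY C hK hgX hι hA).PiXu :=
  (e.temperedCoverDataOfHuu_tp_PiXu ιC hιC hinj op hodd hx hIx hιell hN hY C hK hgX hι hA).symm

/-- **Binder `hβ` DISCHARGED** (granted `IsQuotientMap toTheta`): the topological theta companion `β` of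
`α := e.conjX y` (abc-iut-L6-d5's `Thm16Sub.topCompanion`) satisfies `β (toTheta σ) = toTheta (α σ)` — abc-iut-w6-d051's
`outer_pair_equations`, recorded in the currency of the outer chain. [cite: MochizukiEtTh2009, Thm 1.6 (ii) p.24] -/
theorem orbitEmbeddingOfHuu_topCompanion_toTheta (hq : IsQuotientMap M.toTheta) (y : M.GtpC) (σ : M.PiTemp) :
    Thm16Sub.topCompanion M.toThetaSetting M.toThetaSetting (e.conjX y) (e.map_deltaTemp_conjX y) hq hq
        (M.toTheta σ) = M.toTheta (e.conjX y σ) :=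
  (e.outer_pair_equations hq y).2.1 σ

/-! ## §2. The OUTER capstones at `ofEmbedding (orbitEmbeddingOfHuu …)` with `hα`, `hβ`, `hXuι` gone -/

/-- **Cor 2.8 (iii), conjuncts 3–4 of `ThetaOrbitData.Cor28_iii` at `ofEmbedding (orbitEmbeddingOfHuu …)`, OUTER case**:
for EVERY `y ∈ Π^tp_C` (pair `(e.conjX y, topCompanion …)`), "if `γ` arises from an inner automorphism of `Π^tp_{Ċ̲̲}`
(resp. `Π^tp_{Ċ̲}`), then `γ` preserves `η̲̈^{Θ,l·ℤ}` (resp. `η̈^{Θ,l·ℤ}`)" — modulo Cor 2.8 (iii)'s own binders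
(`Γ_Θ`/`InducesOnTheta`, `hY`, `hYuu`) and P-C5 (`σ₀ ∈ Π^tp_{Ẋ̲̲}`, `hη`) only. [cite: MochizukiEtTh2009, Cor 2.8(iii) p.42] -/
theorem cor28_iii_outer_orbitEmbeddingOfHuu (hq : IsQuotientMap M.toTheta)
    (hC : M.toThetaSetting.Compat) (hS : M.toThetaSetting.Sec2Hyps)
    (y : (e.temperedCoverDataOfHuu ιC hιC hinj op hodd hx hIx hιell hN hY C hK hgX hι hA).Gtp)
    (ΓΘ : (ThetaOrbitData.ofEmbedding
        (e.orbitEmbeddingOfHuu ιC hιC hinj op hodd hx hIx hιell hN hY C hK hgX hι hA τ τ') hC hS).DeltaTheta ≃*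
      (ThetaOrbitData.ofEmbedding
        (e.orbitEmbeddingOfHuu ιC hιC hinj op hodd hx hIx hιell hN hY C hK hgX hι hA τ τ') hC hS).DeltaTheta)
    (hind : (ThetaOrbitData.ofEmbedding
        (e.orbitEmbeddingOfHuu ιC hιC hinj op hodd hx hIx hιell hN hY C hK hgX hι hA τ τ') hC hS).InducesOnTheta
      (ThetaOrbitData.innerAutTop y) ΓΘ)
    (hYmap : (e.temperedCoverDataOfHuu ιC hιC hinj op hodd hx hIx hιell hN hY C hK hgX hι hA).PiYddtp.map
        (ThetaOrbitData.innerAutTop y).toMulEquiv.toMonoidHom =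
      (e.temperedCoverDataOfHuu ιC hιC hinj op hodd hx hIx hιell hN hY C hK hgX hι hA).PiYddtp)
    (hYuu : ((e.temperedCoverDataOfHuu ιC hιC hinj op hodd hx hIx hιell hN hY C hK hgX hι hA).PiYddtp ⊓
          (e.temperedCoverDataOfHuu ιC hιC hinj op hodd hx hIx hιell hN hY C hK hgX hι hA).tp
            (e.temperedCoverDataOfHuu ιC hιC hinj op hodd hx hIx hιell hN hY C hK hgX hι hA).PiXuu).map
        (ThetaOrbitData.innerAutTop y).toMulEquiv.toMonoidHom =
      (e.temperedCoverDataOfHuu ιC hιC hinj op hodd hx hIx hιell hN hY C hK hgX hι hA).PiYddtp ⊓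
        (e.temperedCoverDataOfHuu ιC hιC hinj op hodd hx hIx hιell hN hY C hK hgX hι hA).tp
          (e.temperedCoverDataOfHuu ιC hιC hinj op hodd hx hIx hιell hN hY C hK hgX hι hA).PiXuu)
    {σ₀ : M.PiTemp}
    (hσ₀ : σ₀ ∈ (e.orbitEmbeddingOfHuu ιC hιC hinj op hodd hx hIx hιell hN hY C hK hgX hι hA τ τ').dotXuu)
    (hη : ∀ (hΔ' : ∀ a, a ∈ M.toThetaSetting.DeltaTheta →
          (Thm16Sub.topCompanion M.toThetaSetting M.toThetaSetting (e.conjX y) (e.map_deltaTemp_conjX y)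
            hq hq).symm a ∈ M.toThetaSetting.DeltaTheta)
        (hYα : ∀ g, g ∈ M.toThetaSetting.GtpYdd → e.conjX y g ∈ M.toThetaSetting.GtpYdd),
      haveI := hC.GtpYdd_normal
      ContH1Aut.autMap M.toTheta M.toThetaSetting.DeltaTheta (e.conjX y).symm
          (Thm16Sub.topCompanion M.toThetaSetting M.toThetaSetting (e.conjX y) (e.map_deltaTemp_conjX y)
            hq hq).symm
          (symm_toTheta_eq (e.orbitEmbeddingOfHuu_topCompanion_toTheta hq y)) hΔ'
          (H := M.toThetaSetting.GtpYdd) (H' := M.toThetaSetting.GtpYdd) hYα E.etaDd =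
        ContH1.conj M.toTheta M.toThetaSetting.DeltaTheta σ₀ E.etaDd) :
    (y ∈ (e.temperedCoverDataOfHuu ιC hιC hinj op hodd hx hIx hιell hN hY C hK hgX hι hA).tp
          (e.temperedCoverDataOfHuu ιC hιC hinj op hodd hx hIx hιell hN hY C hK hgX hι hA).PiCuu ⊓
        (e.temperedCoverDataOfHuu ιC hιC hinj op hodd hx hIx hιell hN hY C hK hgX hι hA).PiCdot →
      (ThetaOrbitData.ofEmbedding
          (e.orbitEmbeddingOfHuu ιC hιC hinj op hodd hx hIx hιell hN hY C hK hgX hι hA τ τ') hC hS).transport _ _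
          hYuu ΓΘ
          (ThetaOrbitData.ofEmbedding
            (e.orbitEmbeddingOfHuu ιC hιC hinj op hodd hx hIx hιell hN hY C hK hgX hι hA τ τ') hC hS).rootLZ =
        (ThetaOrbitData.ofEmbedding
          (e.orbitEmbeddingOfHuu ιC hιC hinj op hodd hx hIx hιell hN hY C hK hgX hι hA τ τ') hC hS).rootLZ) ∧
    (y ∈ (e.temperedCoverDataOfHuu ιC hιC hinj op hodd hx hIx hιell hN hY C hK hgX hι hA).tp
          (e.temperedCoverDataOfHuu ιC hιC hinj op hodd hx hIx hιell hN hY C hK hgX hι hA).PiCu ⊓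
        (e.temperedCoverDataOfHuu ιC hιC hinj op hodd hx hIx hιell hN hY C hK hgX hι hA).PiCdot →
      (ThetaOrbitData.ofEmbedding
          (e.orbitEmbeddingOfHuu ιC hιC hinj op hodd hx hIx hιell hN hY C hK hgX hι hA τ τ') hC hS).transport _ _
          hYmap ΓΘ
          (ThetaOrbitData.ofEmbedding
            (e.orbitEmbeddingOfHuu ιC hιC hinj op hodd hx hIx hιell hN hY C hK hgX hι hA τ τ') hC hS).etaLZ =
        (ThetaOrbitData.ofEmbedding
          (e.orbitEmbeddingOfHuu ιC hιC hinj op hodd hx hIx hιell hN hY C hK hgX hι hA τ τ') hC hS).etaLZ) :=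
  (e.orbitEmbeddingOfHuu ιC hιC hinj op hodd hx hIx hιell hN hY C hK hgX hι hA τ τ').ofEmbedding_cor28_iii_outer_reduced
    hC hS (fun σ => e.orbitEmbeddingOfHuu_ι_conjX ιC hιC hinj op hodd hx hIx hιell hN hY C hK hgX hι hA τ τ' y σ)
    (e.orbitEmbeddingOfHuu_topCompanion_toTheta hq y)
    (e.orbitEmbeddingOfHuu_map_GtpXu ιC hιC hinj op hodd hx hIx hιell hN hY C hK hgX hι hA τ τ')
    ΓΘ hind hYmap hYuu hσ₀ hη

/-- **Cor 2.8 (i) at `ofEmbedding (orbitEmbeddingOfHuu …)` for an OUTER conjugator**: for EVERY `y ∈ Π^tp_C` (pair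
`(e.conjX y, topCompanion …)`), ALL FOUR conclusions of `ThetaOrbitData.Cor28_i` hold (standard type preserved; the
three collections agree with their transports up to a root of unity of order `l`, `1`, `1` — indeed exactly, `κ = 1`) —
modulo Cor 2.8 (i)'s own binders (`IsStandard`, `Γ_Θ`/`InducesOnTheta`, `hY`, `hYuu`, the tower stabilities of
`Π^tp_{X̲̲}`, `Π^tp_{X̲}`) and P-C5 (`σ₀ ∈ Π^tp_{X̲̲}`, `hη`) only. [cite: MochizukiEtTh2009, Cor 2.8(i) p.42] -/
theorem cor28_i_outer_orbitEmbeddingOfHuu (hq : IsQuotientMap M.toTheta)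
    (hC : M.toThetaSetting.Compat) (hS : M.toThetaSetting.Sec2Hyps)
    (y : (e.temperedCoverDataOfHuu ιC hιC hinj op hodd hx hIx hιell hN hY C hK hgX hι hA).Gtp)
    (hstd : (ThetaOrbitData.ofEmbedding
        (e.orbitEmbeddingOfHuu ιC hιC hinj op hodd hx hIx hιell hN hY C hK hgX hι hA τ τ') hC hS).IsStandard)
    (ΓΘ : (ThetaOrbitData.ofEmbedding
        (e.orbitEmbeddingOfHuu ιC hιC hinj op hodd hx hIx hιell hN hY C hK hgX hι hA τ τ') hC hS).DeltaTheta ≃*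
      (ThetaOrbitData.ofEmbedding
        (e.orbitEmbeddingOfHuu ιC hιC hinj op hodd hx hIx hιell hN hY C hK hgX hι hA τ τ') hC hS).DeltaTheta)
    (hind : (ThetaOrbitData.ofEmbedding
        (e.orbitEmbeddingOfHuu ιC hιC hinj op hodd hx hIx hιell hN hY C hK hgX hι hA τ τ') hC hS).InducesOnTheta
      (ThetaOrbitData.innerAutTop y) ΓΘ)
    (hYmap : (e.temperedCoverDataOfHuu ιC hιC hinj op hodd hx hIx hιell hN hY C hK hgX hι hA).PiYddtp.map
        (ThetaOrbitData.innerAutTop y).toMulEquiv.toMonoidHom =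
      (e.temperedCoverDataOfHuu ιC hιC hinj op hodd hx hIx hιell hN hY C hK hgX hι hA).PiYddtp)
    (hYuu : ((e.temperedCoverDataOfHuu ιC hιC hinj op hodd hx hIx hιell hN hY C hK hgX hι hA).PiYddtp ⊓
          (e.temperedCoverDataOfHuu ιC hιC hinj op hodd hx hIx hιell hN hY C hK hgX hι hA).tp
            (e.temperedCoverDataOfHuu ιC hιC hinj op hodd hx hIx hιell hN hY C hK hgX hι hA).PiXuu).map
        (ThetaOrbitData.innerAutTop y).toMulEquiv.toMonoidHom =
      (e.temperedCoverDataOfHuu ιC hιC hinj op hodd hx hIx hιell hN hY C hK hgX hι hA).PiYddtp ⊓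
        (e.temperedCoverDataOfHuu ιC hιC hinj op hodd hx hIx hιell hN hY C hK hgX hι hA).tp
          (e.temperedCoverDataOfHuu ιC hιC hinj op hodd hx hIx hιell hN hY C hK hgX hι hA).PiXuu)
    (hXuumap : ((e.temperedCoverDataOfHuu ιC hιC hinj op hodd hx hIx hιell hN hY C hK hgX hι hA).tp
          (e.temperedCoverDataOfHuu ιC hιC hinj op hodd hx hIx hιell hN hY C hK hgX hι hA).PiXuu).map
        (ThetaOrbitData.innerAutTop y).toMulEquiv.toMonoidHom =
      (e.temperedCoverDataOfHuu ιC hιC hinj op hodd hx hIx hιell hN hY C hK hgX hι hA).tp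
        (e.temperedCoverDataOfHuu ιC hιC hinj op hodd hx hIx hιell hN hY C hK hgX hι hA).PiXuu)
    (hXumap : ((e.temperedCoverDataOfHuu ιC hιC hinj op hodd hx hIx hιell hN hY C hK hgX hι hA).tp
          (e.temperedCoverDataOfHuu ιC hιC hinj op hodd hx hIx hιell hN hY C hK hgX hι hA).PiXu).map
        (ThetaOrbitData.innerAutTop y).toMulEquiv.toMonoidHom =
      (e.temperedCoverDataOfHuu ιC hιC hinj op hodd hx hIx hιell hN hY C hK hgX hι hA).tp
        (e.temperedCoverDataOfHuu ιC hιC hinj op hodd hx hIx hιell hN hY C hK hgX hι hA).PiXu)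
    {σ₀ : M.PiTemp} (hσ₀ : σ₀ ∈ C.Huu)
    (hη : ∀ (hΔ' : ∀ a, a ∈ M.toThetaSetting.DeltaTheta →
          (Thm16Sub.topCompanion M.toThetaSetting M.toThetaSetting (e.conjX y) (e.map_deltaTemp_conjX y)
            hq hq).symm a ∈ M.toThetaSetting.DeltaTheta)
        (hYα : ∀ g, g ∈ M.toThetaSetting.GtpYdd → e.conjX y g ∈ M.toThetaSetting.GtpYdd),
      haveI := hC.GtpYdd_normal
      ContH1Aut.autMap M.toTheta M.toThetaSetting.DeltaTheta (e.conjX y).symm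
          (Thm16Sub.topCompanion M.toThetaSetting M.toThetaSetting (e.conjX y) (e.map_deltaTemp_conjX y)
            hq hq).symm
          (symm_toTheta_eq (e.orbitEmbeddingOfHuu_topCompanion_toTheta hq y)) hΔ'
          (H := M.toThetaSetting.GtpYdd) (H' := M.toThetaSetting.GtpYdd) hYα E.etaDd =
        ContH1.conj M.toTheta M.toThetaSetting.DeltaTheta σ₀ E.etaDd) :
    (ThetaOrbitData.ofEmbedding
        (e.orbitEmbeddingOfHuu ιC hιC hinj op hodd hx hIx hιell hN hY C hK hgX hι hA τ τ') hC hS).IsStandardColl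
        ((ThetaOrbitData.ofEmbedding
            (e.orbitEmbeddingOfHuu ιC hιC hinj op hodd hx hIx hιell hN hY C hK hgX hι hA τ τ') hC hS).transport _
          (ThetaOrbitData.innerAutTop y) hYmap ΓΘ
          (ThetaOrbitData.ofEmbedding
            (e.orbitEmbeddingOfHuu ιC hιC hinj op hodd hx hIx hιell hN hY C hK hgX hι hA τ τ') hC hS).etaZMu2) ∧
      (ThetaOrbitData.ofEmbedding
          (e.orbitEmbeddingOfHuu ιC hιC hinj op hodd hx hIx hιell hN hY C hK hgX hι hA τ τ') hC hS).EqUpToRootOfUnity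
          l _
        (ThetaOrbitData.ofEmbedding
          (e.orbitEmbeddingOfHuu ιC hιC hinj op hodd hx hIx hιell hN hY C hK hgX hι hA τ τ') hC hS).rootLZMu2
        ((ThetaOrbitData.ofEmbedding
            (e.orbitEmbeddingOfHuu ιC hιC hinj op hodd hx hIx hιell hN hY C hK hgX hι hA τ τ') hC hS).transport _
          (ThetaOrbitData.innerAutTop y) hYuu ΓΘ
          (ThetaOrbitData.ofEmbedding
            (e.orbitEmbeddingOfHuu ιC hιC hinj op hodd hx hIx hιell hN hY C hK hgX hι hA τ τ') hC hS).rootLZMu2) ∧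
      (ThetaOrbitData.ofEmbedding
          (e.orbitEmbeddingOfHuu ιC hιC hinj op hodd hx hIx hιell hN hY C hK hgX hι hA τ τ') hC hS).EqUpToRootOfUnity
          1 _
        (ThetaOrbitData.ofEmbedding
          (e.orbitEmbeddingOfHuu ιC hιC hinj op hodd hx hIx hιell hN hY C hK hgX hι hA τ τ') hC hS).etaZMu2
        ((ThetaOrbitData.ofEmbedding
            (e.orbitEmbeddingOfHuu ιC hιC hinj op hodd hx hIx hιell hN hY C hK hgX hι hA τ τ') hC hS).transport _
          (ThetaOrbitData.innerAutTop y) hYmap ΓΘ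
          (ThetaOrbitData.ofEmbedding
            (e.orbitEmbeddingOfHuu ιC hιC hinj op hodd hx hIx hιell hN hY C hK hgX hι hA τ τ') hC hS).etaZMu2) ∧
      (ThetaOrbitData.ofEmbedding
          (e.orbitEmbeddingOfHuu ιC hιC hinj op hodd hx hIx hιell hN hY C hK hgX hι hA τ τ') hC hS).EqUpToRootOfUnity
          1 _
        (ThetaOrbitData.ofEmbedding
          (e.orbitEmbeddingOfHuu ιC hιC hinj op hodd hx hIx hιell hN hY C hK hgX hι hA τ τ') hC hS).etaLZMu2
        ((ThetaOrbitData.ofEmbedding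
            (e.orbitEmbeddingOfHuu ιC hιC hinj op hodd hx hIx hιell hN hY C hK hgX hι hA τ τ') hC hS).transport _
          (ThetaOrbitData.innerAutTop y) hYmap ΓΘ
          (ThetaOrbitData.ofEmbedding
            (e.orbitEmbeddingOfHuu ιC hιC hinj op hodd hx hIx hιell hN hY C hK hgX hι hA τ τ') hC hS).etaLZMu2) :=
  (e.orbitEmbeddingOfHuu ιC hιC hinj op hodd hx hIx hιell hN hY C hK hgX hι hA τ τ').ofEmbedding_cor28_i_outer_reduced
    hC hS hstd (fun σ => e.orbitEmbeddingOfHuu_ι_conjX ιC hιC hinj op hodd hx hIx hιell hN hY C hK hgX hι hA τ τ' y σ)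
    (e.orbitEmbeddingOfHuu_topCompanion_toTheta hq y)
    (e.orbitEmbeddingOfHuu_map_GtpXu ιC hιC hinj op hodd hx hIx hιell hN hY C hK hgX hι hA τ τ')
    ΓΘ hind hYmap hYuu hXuumap hXumap hσ₀ hη

end Generic

end MuTwoSetting.CLevelData

/-! ## §3. The quotient-map input at the cusped χ-model -/

namespace SettingModel

variable (p : ℕ) [Fact p.Prime]

/-- **`Π^tp_X ↠ (Π^tp_X)^Θ` is a quotient map at the cusped χ-model `modelχ′`** (abc-iut-w5-d111's generic
`CurveTheta.isQuotientMap_toTheta` at `curveχ′`; the `hq` input of §2 at `MuTwoSetting.inversionModelχ′` /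
`MuTwoSetting.modelχ′`, whose theta setting IS `modelχ′`). [cite: MochizukiEtTh2009, §1 p.12] -/
theorem isQuotientMap_toTheta_modelχ' : IsQuotientMap (ThetaSetting.modelχ' p).toTheta :=
  CurveTheta.isQuotientMap_toTheta (curveχ' p)

/-- The same statement read at abc-iut-L2-d3's instance site `MuTwoSetting.inversionModelχ′`.
[cite: MochizukiEtTh2009, §1 p.12] -/
theorem isQuotientMap_toTheta_inversionModelχ' : IsQuotientMap (MuTwoSetting.inversionModelχ' p).toTheta :=
  isQuotientMap_toTheta_modelχ' p

end SettingModel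

end Literature.AnabelianGeometry.EtaleTheta

end
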